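import Summits.CriticalPhenomena.PercolationContinuityZ3.Theorems.Transplant.AutEndStateFCAction
import Summits.CriticalPhenomena.PercolationContinuityZ3.Theorems.Transplant.AutEndStateCayley
import Summits.CriticalPhenomena.PercolationContinuityZ3.Theorems.Transplant.StatementBoxProdZ2
import HarnessLib

/-!
# The FC-split end state for actions whose stabilisers are KILLED by the characters (not necessarily finite), and its customer: `p_c < 1` and
# `θ(p_c) = 0` on `X □ Cay(Γ; S)` for every connected locally finite QUASI-TRANSITIVE `X` and every `Γ` with a finite-index subgroup carrying two
# independent characters and a central element they do not kill (every finite generating set `S`)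

builds on p205010 (kernel theorem, internal audit signed; external expert review pending).  Lane `prim-bschramm`, seat `prim-bschramm-gen-1` gen 7 (GEN pen,
p3 lineage), CUSTOMERS of the design owner p3-g32's covering-route theorem «AutEndStateFC» (`AutCyl.conj4_of_orbitDatum_fc`, RULING L-Q3-2).  Helper file
(`--supports stmt-CriticalPhenomena-4575 --as helper`); def-free; unconditional.  NOTHING is claimed about the `@[conjecture]` `BenjaminiSchramm1996_conj4_endState`:
only its FC-split sub-case is used, exactly as landed in «AutEndStateFC».

* §1 `AutCyl.exists_endStateInput_of_stabilizers_killed` — gen-5 g3's descent («AutProperVirtuallyNilpotent» §3) with 'every stabiliser KILLED by `(ψ₀, ψ₁)`' in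
  place of 'finite stabilisers' (finiteness is used there only to kill them): the character kills the kernel of `A → Aut X` (it fixes every vertex), so it descends
  to the image `A₀`.  It subsumes the finite-stabiliser descent (a finite subgroup has trivial image in `ℤ²`, `AutPoly.map_eq_one_of_finite_image`) — not re-derived.
* §2 `AutCyl.conj4_fc_of_stabilizersKilled` — `A` acting by automorphisms with finitely many orbits, stabilisers killed by two independent characters `ψ₀, ψ₁`,
  and `z` with `(ψ₀ z, ψ₁ z) ≠ 0` commuting with a finite-index `N ≤ A` ⟹ `p_c < 1 ∧ θ_x(p_c) = 0` at every vertex (+ the central form).  (b2)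
  «AutEndStateFCAction» is the finite-stabiliser case.
* §3 `EndStateBoxProd.boxProd_cayley_conj4_of_vfc` — **`X □ Cay(Γ; S)`, `X` connected locally finite QUASI-transitive, `Γ ⊇ Γ₀` of finite index with
  independent `ψ₀, ψ₁ : Γ₀ → ℤ` and `z ∈ Γ₀`, `(ψ₀ z, ψ₁ z) ≠ 0`, commuting with a finite-index `N₀ ≤ Γ₀`, EVERY finite generating `S`** (central form
  `boxProd_cayley_conj4_of_vb1_central`): the group `Aut(X) × Γ₀` acts by `(α, h) • (x, g) =
  (α x, h g)` with orbits `(Aut X-orbits) × (right cosets)`, stabilisers `Stab(x) × 1` (possibly infinite — `X` a regular tree — but killed by `ψ ∘ snd`), witness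
  `(1, z)`; instances `boxProd_cayley_conj4_of_central` (`Γ₀ = Γ`), `boxProd_cayley_prod_zd` (`X □ Cay(K × ℤ^d; S)`, `K` ANY group), `boxProd_cayley_of_virtually_prod_zd`.

WHAT IS ALREADY IN THE TREE (not restated; the new rows are INCOMPARABLE with it, not more general): «SkeletonFrmScaled1CustomersHoldsA»
`CayleyScaled.boxProd_criticalContinuity_of_rank_holds` — `X` VERTEX-transitive, a rank-two `φ` on `Γ` ITSELF, NO FC witness (so `X □ Cay(F₂; S)` is there, not
here); `bsConj4_boxProdZ2_holds` — `X □ ℤ²` for quasi-transitive `X`.  NEW here = quasi-transitive (not vertex-transitive) factor × characters on a finite-index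
`Γ₀` × arbitrary `S`, paid for by the central / FC survivor.
[cite: BenjaminiSchramm1996, Conj. 4; §2 (almost transitive graphs)] [cite: MartineauSevero2019, Cor. 2.2] [cite: Hutchcroft2016, Thm. 1.1]
-/

noncomputable section

namespace Summit.CriticalPhenomena.PercolationContinuityZ3.Theorems.Transplant

open SimpleGraph Literature.Barriers.CriticalPhenomena Literature.Probability.LatticeModels Literature.Probability.Percolation
open scoped Classical

namespace AutCyl

variable {W : Type} {X : SimpleGraph W} {A : Type} [Group A] [MulAction A W] {reps : Finset W}

/-- Two characters vanishing at `g` make the paired `ℤ²`-character vanish at `g`. [folklore] -/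
theorem pairHom_eq_one {ψ₀ ψ₁ : A →* Multiplicative ℤ} {g : A} (h₀ : ψ₀ g = 1) (h₁ : ψ₁ g = 1) : CayleyScaled.pairHom ψ₀ ψ₁ g = 1 := by
  apply Multiplicative.toAdd.injective
  funext i
  fin_cases i
  · show Multiplicative.toAdd (CayleyScaled.pairHom ψ₀ ψ₁ g) 0 = Multiplicative.toAdd (1 : Multiplicative (Site 2)) 0
    rw [CayleyScaled.toAdd_pairHom_zero, h₀, toAdd_one, toAdd_one, Pi.zero_apply]
  · show Multiplicative.toAdd (CayleyScaled.pairHom ψ₀ ψ₁ g) 1 = Multiplicative.toAdd (1 : Multiplicative (Site 2)) 1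
    rw [CayleyScaled.toAdd_pairHom_one, h₁, toAdd_one, toAdd_one, Pi.zero_apply]

/-- The paired character is non-trivial at `g` as soon as one coordinate is. [folklore] -/
theorem pairHom_ne_one {ψ₀ ψ₁ : A →* Multiplicative ℤ} {g : A} (h : ψ₀ g ≠ 1 ∨ ψ₁ g ≠ 1) : CayleyScaled.pairHom ψ₀ ψ₁ g ≠ 1 := by
  intro hg
  have h0 : Multiplicative.toAdd (CayleyScaled.pairHom ψ₀ ψ₁ g) 0 = 0 := by rw [hg, toAdd_one, Pi.zero_apply]
  have h1 : Multiplicative.toAdd (CayleyScaled.pairHom ψ₀ ψ₁ g) 1 = 0 := by rw [hg, toAdd_one, Pi.zero_apply]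
  rw [CayleyScaled.toAdd_pairHom_zero] at h0
  rw [CayleyScaled.toAdd_pairHom_one] at h1
  rcases h with h' | h'
  · exact h' (toAdd_eq_zero.1 h0)
  · exact h' (toAdd_eq_zero.1 h1)

/-! ## §1 The end-state input from an action whose stabilisers are killed by the characters -/

/-- **THE END-STATE INPUT from a cocompact action with two independent characters KILLING EVERY STABILISER** (stabilisers of any size).  `A₀ :=` the image of
`A → Aut(X)`, `e : A ↠ A₀`; the kernel of `e` fixes every vertex, so `(ψ₀, ψ₁)` kills it and DESCENDS to `c : A₀ → ℤ²` with `c (e g) = (ψ₀ g, ψ₁ g)`; `c` kills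
every `A₀`-stabiliser, has rank two on `e a, e b`, and `reps` still meets every `A₀`-orbit (adapted from gen-5 g3's `exists_endStateInput_of_stabilizers_finite`,
whose finite stabilisers are a special case of killed ones). [cite: BenjaminiSchramm1996, §2 (almost transitive graphs)] -/
theorem exists_endStateInput_of_stabilizers_killed (hact : IsActionByAut X A) (hcover : ∀ w : W, ∃ a : A, ∃ r ∈ reps, a • r = w) (hne : reps.Nonempty)
    (ψ₀ ψ₁ : A →* Multiplicative ℤ) (a b : A)
    (hind : Multiplicative.toAdd (ψ₀ a) * Multiplicative.toAdd (ψ₁ b) ≠ Multiplicative.toAdd (ψ₁ a) * Multiplicative.toAdd (ψ₀ b))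
    (hkill : ∀ (g : A) (w : W), g • w = w → ψ₀ g = 1 ∧ ψ₁ g = 1) :
    ∃ (A₀ : Subgroup (X ≃g X)) (e : A →* A₀) (c : A₀ →* Multiplicative (Site 2)),
      Function.Surjective e ∧ (∀ (g : A) (w : W), ((e g : A₀) : X ≃g X) w = g • w) ∧ (∀ g : A, c (e g) = CayleyScaled.pairHom ψ₀ ψ₁ g) ∧
      (∀ w : W, ∃ x : A₀, ∃ s ∈ reps, (x : X ≃g X) s = w) ∧ (∀ (x : A₀) (w : W), (x : X ≃g X) w = w → c x = 1) ∧
      ∃ x y : A₀, MaxArea.det2 (Multiplicative.toAdd (c x)) (Multiplicative.toAdd (c y)) ≠ 0 := by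
  -- adapted from «AutProperVirtuallyNilpotent» `exists_endStateInput_of_stabilizers_finite` (gen-5 g3)
  obtain ⟨r₀, -⟩ := hne
  let ι : A →* (X ≃g X) :=
    { toFun := fun g => smulIso hact g
      map_one' := RelIso.ext fun w => by show (1 : A) • w = w; exact one_smul A w
      map_mul' := fun g g' => RelIso.ext fun w => by show (g * g') • w = g • g' • w; exact mul_smul g g' w }
  have hι : ∀ (g : A) (w : W), ι g w = g • w := fun g w => rfl
  set A₀ : Subgroup (X ≃g X) := ι.range with hA₀
  let e : A →* A₀ := ι.rangeRestrict
  have hesurj : Function.Surjective e := ι.rangeRestrict_surjective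
  have he : ∀ (g : A) (w : W), ((e g : A₀) : X ≃g X) w = g • w := fun g w => by
    show (ι.rangeRestrict g : X ≃g X) w = g • w
    rw [MonoidHom.coe_rangeRestrict, hι]
  set c₀ : A →* Multiplicative (Site 2) := CayleyScaled.pairHom ψ₀ ψ₁ with hc₀
  have hkill' : ∀ (g : A) (w : W), g • w = w → c₀ g = 1 := fun g w hgw => pairHom_eq_one (hkill g w hgw).1 (hkill g w hgw).2
  have hker : e.ker ≤ c₀.ker := fun g hg => by
    rw [MonoidHom.mem_ker] at hg ⊢
    have h1 : ((e g : A₀) : X ≃g X) r₀ = r₀ := by rw [hg]; rfl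
    rw [he] at h1
    exact hkill' g r₀ h1
  let c : A₀ →* Multiplicative (Site 2) := e.liftOfRightInverse (Function.surjInv hesurj) (Function.rightInverse_surjInv hesurj) ⟨c₀, hker⟩
  have hc : ∀ g : A, c (e g) = c₀ g := fun g =>
    MonoidHom.liftOfRightInverse_comp_apply e (Function.surjInv hesurj) (Function.rightInverse_surjInv hesurj) ⟨c₀, hker⟩ g
  refine ⟨A₀, e, c, hesurj, he, hc, fun w => ?_, fun x w hxw => ?_, ?_⟩
  · obtain ⟨g, s, hs, hw⟩ := hcover w
    exact ⟨e g, s, hs, by rw [he, hw]⟩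
  · obtain ⟨g, rfl⟩ := hesurj x
    rw [he] at hxw
    rw [hc]
    exact hkill' g w hxw
  · refine ⟨e a, e b, ?_⟩
    rw [hc, hc, MaxArea.det2, hc₀, CayleyScaled.toAdd_pairHom_zero, CayleyScaled.toAdd_pairHom_one, CayleyScaled.toAdd_pairHom_zero,
      CayleyScaled.toAdd_pairHom_one]
    exact sub_ne_zero.2 hind

/-! ## §2 The FC-split end state for such actions -/

/-- **FC FORM, STABILISERS KILLED — `p_c < 1` and `θ_x(p_c) = 0` at every vertex of every connected locally finite graph carrying an action by automorphisms
with finitely many orbits of a group `A` with two independent characters `ψ₀, ψ₁ : A → ℤ` KILLING EVERY STABILISER and an element `z`, `(ψ₀ z, ψ₁ z) ≠ 0`,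
commuting with a finite-index `N ≤ A`** — §1 + p3-g32's «AutEndStateFC» `conj4_of_orbitDatum_fc` (image of `z` keeps a non-trivial character, `N.map e` keeps
finite index by `Subgroup.index_map_dvd`); `p_c < 1` by the rank-two character («AutChartQuasiTransitive»).  (b2)'s `conj4_fc_of_finiteStabilizers` is the case
of finite stabilisers.  builds on p205010 (kernel theorem, internal audit signed; external expert review pending).
[cite: BenjaminiSchramm1996, Conj. 4; §2 (almost transitive graphs)] [cite: MartineauSevero2019, Cor. 2.2] [cite: Hutchcroft2016, Thm. 1.1] -/
theorem conj4_fc_of_stabilizersKilled [X.LocallyFinite] (hc : X.Connected) (hact : IsActionByAut X A) (reps : Finset W)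
    (hcover : ∀ w : W, ∃ a : A, ∃ r ∈ reps, a • r = w) (ψ₀ ψ₁ : A →* Multiplicative ℤ) (a b : A)
    (hind : Multiplicative.toAdd (ψ₀ a) * Multiplicative.toAdd (ψ₁ b) ≠ Multiplicative.toAdd (ψ₁ a) * Multiplicative.toAdd (ψ₀ b))
    (hkill : ∀ (g : A) (w : W), g • w = w → ψ₀ g = 1 ∧ ψ₁ g = 1)
    (z : A) (hψz : ψ₀ z ≠ 1 ∨ ψ₁ z ≠ 1) (N : Subgroup A) [hN : N.FiniteIndex] (hNz : ∀ n ∈ N, n * z = z * n) (x : W) :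
    criticalProb X x < 1 ∧ theta X x (criticalProbIOf X x) = 0 := by
  have hne : reps.Nonempty := by
    obtain ⟨-, r, hr, -⟩ := hcover x
    exact ⟨r, hr⟩
  obtain ⟨A₀, e, c, hesurj, -, hce, horb, hstab, hrank⟩ :=
    exists_endStateInput_of_stabilizers_killed (X := X) (reps := reps) hact hcover hne ψ₀ ψ₁ a b hind hkill
  have hg : c (e z) ≠ 1 := by rw [hce]; exact pairHom_ne_one hψz
  haveI : (N.map e).FiniteIndex := ⟨fun h0 => by
    have hd := Subgroup.index_map_dvd N hesurj
    rw [h0, zero_dvd_iff] at hd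
    exact hN.1 hd⟩
  have hN' : ∀ n' ∈ N.map e, n' * e z = e z * n' := fun n' hn' => by
    obtain ⟨n, hn, rfl⟩ := Subgroup.mem_map.1 hn'
    rw [← map_mul, ← map_mul, hNz n hn]
  refine ⟨?_, conj4_of_orbitDatum_fc X hc A₀ reps c horb hstab hrank (e z) hg (N.map e) hN' x⟩
  refine AutChart.criticalProb_lt_one_of_finite_orbits hact hc x reps hcover (CayleyScaled.pairHom ψ₀ ψ₁)
    (fun h hh => pairHom_eq_one (hkill h x (MulAction.mem_stabilizer_iff.1 hh)).1 (hkill h x (MulAction.mem_stabilizer_iff.1 hh)).2) ⟨a, b, ?_⟩ x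
  rw [MaxArea.det2, CayleyScaled.toAdd_pairHom_zero, CayleyScaled.toAdd_pairHom_one, CayleyScaled.toAdd_pairHom_zero,
    CayleyScaled.toAdd_pairHom_one]
  exact sub_ne_zero.2 hind

/-- **Central form, stabilisers killed** (`N = A`). builds on p205010 (kernel theorem, internal audit signed; external expert review pending).
[cite: BenjaminiSchramm1996, Conj. 4; §2 (almost transitive graphs)] [cite: MartineauSevero2019, Cor. 2.2] -/
theorem conj4_central_of_stabilizersKilled [X.LocallyFinite] (hc : X.Connected) (hact : IsActionByAut X A) (reps : Finset W)
    (hcover : ∀ w : W, ∃ a : A, ∃ r ∈ reps, a • r = w) (ψ₀ ψ₁ : A →* Multiplicative ℤ) (a b : A)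
    (hind : Multiplicative.toAdd (ψ₀ a) * Multiplicative.toAdd (ψ₁ b) ≠ Multiplicative.toAdd (ψ₁ a) * Multiplicative.toAdd (ψ₀ b))
    (hkill : ∀ (g : A) (w : W), g • w = w → ψ₀ g = 1 ∧ ψ₁ g = 1)
    (z : A) (hz : z ∈ Subgroup.center A) (hψz : ψ₀ z ≠ 1 ∨ ψ₁ z ≠ 1) (x : W) :
    criticalProb X x < 1 ∧ theta X x (criticalProbIOf X x) = 0 :=
  conj4_fc_of_stabilizersKilled hc hact reps hcover ψ₀ ψ₁ a b hind hkill z hψz ⊤ (fun n _ => (Subgroup.mem_center_iff.1 hz) n) x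

end AutCyl

/-! ## §3 The customer: `X □ Cay(Γ; S)` with `X` quasi-transitive and the virtual central datum on `Γ` -/

namespace EndStateBoxProd

variable {Γ : Type} [Group Γ] {W : Type} (X : SimpleGraph W) [X.LocallyFinite]

/-- **`p_c < 1` and `θ(p_c) = 0` on `X □ Cay(Γ; S)` for every connected locally finite QUASI-TRANSITIVE `X`, every finite generating `S`, and every `Γ` with a
finite-index `Γ₀` carrying two independent characters `ψ₀, ψ₁` and an element `z ∈ Γ₀` that they do not kill, commuting with a finite-index `N₀ ≤ Γ₀` (an FC
witness; `N₀ = Γ₀`: `boxProd_cayley_conj4_of_vb1_central`).**  The group `Aut(X) × Γ₀` acts by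
`(α, h) • (x, g) = (α x, h g)` (automorphisms: `boxProdIso α (leftMulIso S h)`), with finitely many orbits (a finite set `V₀` meeting every `Aut X`-orbit times right-coset
representatives of `Γ₀`), stabilisers `Stab(x) × 1` — of ANY size — killed by `ψ ∘ snd`, the witness `(1, z)` and the finite-index `Aut(X) × N₀`
(`Subgroup.index_prod`); then §2.  Incomparable with the tree's
`CayleyScaled.boxProd_criticalContinuity_of_rank_holds` (`X` vertex-transitive, characters on `Γ`, no witness).
builds on p205010 (kernel theorem, internal audit signed; external expert review pending).
[cite: BenjaminiSchramm1996, Conj. 4; §2 (almost transitive graphs)] [cite: MartineauSevero2019, Cor. 2.2] [cite: Hutchcroft2016, Thm. 1.1] -/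
theorem boxProd_cayley_conj4_of_vfc (hcX : X.Connected) (hq : IsQuasiTransitive X) (S : Finset Γ) (hS : Subgroup.closure (S : Set Γ) = ⊤)
    (Γ₀ : Subgroup Γ) [Γ₀.FiniteIndex] (ψ₀ ψ₁ : Γ₀ →* Multiplicative ℤ) (a b : Γ₀)
    (hind : Multiplicative.toAdd (ψ₀ a) * Multiplicative.toAdd (ψ₁ b) ≠ Multiplicative.toAdd (ψ₁ a) * Multiplicative.toAdd (ψ₀ b))
    (z : Γ₀) (hψz : ψ₀ z ≠ 1 ∨ ψ₁ z ≠ 1) (N₀ : Subgroup Γ₀) [hN₀ : N₀.FiniteIndex] (hN₀z : ∀ n ∈ N₀, n * z = z * n) (v : W × Γ) :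
    criticalProb (X □ mulCayley (↑S : Set Γ)) v < 1 ∧
      theta (X □ mulCayley (↑S : Set Γ)) v (criticalProbIOf (X □ mulCayley (↑S : Set Γ)) v) = 0 := by
  -- the action of `Aut(X) × Γ₀` on `W × Γ`
  letI : MulAction ((X ≃g X) × Γ₀) (W × Γ) :=
    { smul := fun q p => (q.1 p.1, (q.2 : Γ) * p.2)
      one_smul := fun p => Prod.ext rfl (one_mul p.2)
      mul_smul := fun q q' p => Prod.ext rfl (mul_assoc _ _ _) }
  have hsmul : ∀ (q : (X ≃g X) × Γ₀) (p : W × Γ), q • p = (q.1 p.1, (q.2 : Γ) * p.2) := fun _ _ => rfl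
  have hact : IsActionByAut (X □ mulCayley (↑S : Set Γ)) ((X ≃g X) × Γ₀) := fun q p p' => by
    rw [hsmul, hsmul]
    exact (boxProdIso q.1 (leftMulIso S (q.2 : Γ))).map_rel_iff'
  have hconn : (X □ mulCayley (↑S : Set Γ)).Connected := hcX.boxProd (CayleyScaled.connected_mulCayley_of_closure S hS)
  -- finitely many orbits: `V₀ × (right-coset representatives)`
  obtain ⟨V₀, hV⟩ := hq
  let ρ : Γ → Γ := fun w => ((QuotientGroup.mk (w⁻¹) : Γ ⧸ Γ₀).out)⁻¹
  have hρ : ∀ w : Γ, w * (ρ w)⁻¹ ∈ Γ₀ := fun w => by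
    obtain ⟨k, hk⟩ := QuotientGroup.mk_out_eq_mul Γ₀ w⁻¹
    show w * (((QuotientGroup.mk (w⁻¹) : Γ ⧸ Γ₀).out)⁻¹)⁻¹ ∈ Γ₀
    rw [inv_inv, hk, mul_inv_cancel_left]
    exact k.2
  set repsΓ : Finset Γ := (Set.finite_range fun q : Γ ⧸ Γ₀ => (q.out)⁻¹).toFinset with hreps
  have hρmem : ∀ w, ρ w ∈ repsΓ := fun w => by rw [hreps, Set.Finite.mem_toFinset]; exact ⟨_, rfl⟩
  have hcover : ∀ p : W × Γ, ∃ q : (X ≃g X) × Γ₀, ∃ r ∈ V₀ ×ˢ repsΓ, q • r = p := fun p => by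
    obtain ⟨γ, hγ⟩ := hV p.1
    refine ⟨(γ.symm, ⟨p.2 * (ρ p.2)⁻¹, hρ p.2⟩), (γ p.1, ρ p.2), Finset.mem_product.2 ⟨hγ, hρmem p.2⟩, ?_⟩
    rw [hsmul]
    exact Prod.ext (RelIso.symm_apply_apply γ p.1) (inv_mul_cancel_right p.2 (ρ p.2))
  -- the characters `ψ ∘ snd` kill every stabiliser `Stab(x) × 1`
  have hkill : ∀ (q : (X ≃g X) × Γ₀) (p : W × Γ), q • p = p →
      ψ₀.comp (MonoidHom.snd (X ≃g X) Γ₀) q = 1 ∧ ψ₁.comp (MonoidHom.snd (X ≃g X) Γ₀) q = 1 := fun q p hqp => by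
    rw [hsmul] at hqp
    have h2 : (q.2 : Γ) * p.2 = p.2 := congrArg Prod.snd hqp
    have hq2 : q.2 = 1 := Subtype.ext (mul_eq_right.1 h2)
    rw [MonoidHom.comp_apply, MonoidHom.comp_apply, MonoidHom.coe_snd, hq2, map_one, map_one]
    exact ⟨rfl, rfl⟩
  -- the finite-index subgroup `Aut(X) × N₀` commutes with the witness `(1, z)`
  haveI : ((⊤ : Subgroup (X ≃g X)).prod N₀).FiniteIndex := ⟨by
    rw [Subgroup.index_prod, Subgroup.index_top, one_mul]; exact hN₀.1⟩
  refine AutCyl.conj4_fc_of_stabilizersKilled hconn hact (V₀ ×ˢ repsΓ) hcover (ψ₀.comp (MonoidHom.snd _ _)) (ψ₁.comp (MonoidHom.snd _ _))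
    (1, a) (1, b) hind hkill (1, z) hψz ((⊤ : Subgroup (X ≃g X)).prod N₀) (fun q hq => Prod.ext ?_ (hN₀z q.2 (Subgroup.mem_prod.1 hq).2)) v
  show q.1 * 1 = 1 * q.1
  rw [mul_one, one_mul]

/-- **Central form**: `z` commuting with all of `Γ₀` (`N₀ = Γ₀`). builds on p205010 (kernel theorem, internal audit signed; external expert review pending).
[cite: BenjaminiSchramm1996, Conj. 4; §2 (almost transitive graphs)] [cite: MartineauSevero2019, Cor. 2.2] -/
theorem boxProd_cayley_conj4_of_vb1_central (hcX : X.Connected) (hq : IsQuasiTransitive X) (S : Finset Γ) (hS : Subgroup.closure (S : Set Γ) = ⊤)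
    (Γ₀ : Subgroup Γ) [Γ₀.FiniteIndex] (ψ₀ ψ₁ : Γ₀ →* Multiplicative ℤ) (a b : Γ₀)
    (hind : Multiplicative.toAdd (ψ₀ a) * Multiplicative.toAdd (ψ₁ b) ≠ Multiplicative.toAdd (ψ₁ a) * Multiplicative.toAdd (ψ₀ b))
    (z : Γ₀) (hz : ∀ h : Γ₀, h * z = z * h) (hψz : ψ₀ z ≠ 1 ∨ ψ₁ z ≠ 1) (v : W × Γ) :
    criticalProb (X □ mulCayley (↑S : Set Γ)) v < 1 ∧
      theta (X □ mulCayley (↑S : Set Γ)) v (criticalProbIOf (X □ mulCayley (↑S : Set Γ)) v) = 0 :=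
  boxProd_cayley_conj4_of_vfc X hcX hq S hS Γ₀ ψ₀ ψ₁ a b hind z hψz ⊤ (fun n _ => hz n) v

/-- **`Γ₀ = Γ` form: `X □ Cay(Γ; S)` with `X` quasi-transitive, two independent characters of `Γ` and a CENTRAL element of `Γ` they do not kill** (for `X`
VERTEX-transitive this is already the one-type node's `CayleyScaled.boxProd_criticalContinuity_of_rank_holds`, with no central element).
builds on p205010 (kernel theorem, internal audit signed; external expert review pending).
[cite: BenjaminiSchramm1996, Conj. 4; §2 (almost transitive graphs)] [cite: MartineauSevero2019, Cor. 2.2] -/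
theorem boxProd_cayley_conj4_of_central (hcX : X.Connected) (hq : IsQuasiTransitive X) (S : Finset Γ) (hS : Subgroup.closure (S : Set Γ) = ⊤)
    (ψ₀ ψ₁ : Γ →* Multiplicative ℤ) (a b : Γ)
    (hind : Multiplicative.toAdd (ψ₀ a) * Multiplicative.toAdd (ψ₁ b) ≠ Multiplicative.toAdd (ψ₁ a) * Multiplicative.toAdd (ψ₀ b))
    (z : Γ) (hz : z ∈ Subgroup.center Γ) (hψz : ψ₀ z ≠ 1 ∨ ψ₁ z ≠ 1) (v : W × Γ) :
    criticalProb (X □ mulCayley (↑S : Set Γ)) v < 1 ∧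
      theta (X □ mulCayley (↑S : Set Γ)) v (criticalProbIOf (X □ mulCayley (↑S : Set Γ)) v) = 0 :=
  boxProd_cayley_conj4_of_vb1_central X hcX hq S hS ⊤ (ψ₀.comp (Subgroup.subtype ⊤)) (ψ₁.comp (Subgroup.subtype ⊤)) ⟨a, Subgroup.mem_top a⟩
    ⟨b, Subgroup.mem_top b⟩ hind ⟨z, Subgroup.mem_top z⟩ (fun h => Subtype.ext ((Subgroup.mem_center_iff.1 hz) h)) hψz v

/-- **`X □ Cay(K × ℤ^d; S)`, `d ≥ 2`, `K` ANY group, `X` connected locally finite quasi-transitive, EVERY finite generating set `S` of the product**: `p_c < 1` and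
`θ(p_c) = 0` at every vertex (datum «AutEndStateFCAction» `AutCyl.exists_centralDatum_prod_zd`).
builds on p205010 (kernel theorem, internal audit signed; external expert review pending).
[cite: BenjaminiSchramm1996, Conj. 4; §2 (almost transitive graphs)] [cite: MartineauSevero2019, Cor. 2.2] [cite: Hutchcroft2016, Thm. 1.1] -/
theorem boxProd_cayley_prod_zd (hcX : X.Connected) (hq : IsQuasiTransitive X) {K : Type} [Group K] {d : ℕ} (hd : 2 ≤ d)
    (S : Finset (K × Multiplicative (Fin d → ℤ))) (hS : Subgroup.closure (S : Set (K × Multiplicative (Fin d → ℤ))) = ⊤)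
    (v : W × (K × Multiplicative (Fin d → ℤ))) :
    criticalProb (X □ mulCayley (↑S : Set (K × Multiplicative (Fin d → ℤ)))) v < 1 ∧
      theta (X □ mulCayley (↑S : Set (K × Multiplicative (Fin d → ℤ)))) v
        (criticalProbIOf (X □ mulCayley (↑S : Set (K × Multiplicative (Fin d → ℤ)))) v) = 0 := by
  obtain ⟨ψ₀, ψ₁, a, b, hind, ha, hψa⟩ := AutCyl.exists_centralDatum_prod_zd K hd
  exact boxProd_cayley_conj4_of_central X hcX hq S hS ψ₀ ψ₁ a b hind a ha (Or.inl hψa) v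

/-- **`X □ Cay(Γ; S)` for `Γ` VIRTUALLY `K × ℤ^d`, `d ≥ 2`** (an injective `ι : K × ℤ^d → Γ` with finite-index image), `X` connected locally finite quasi-transitive,
every finite generating `S`: `p_c < 1` and `θ(p_c) = 0` at every vertex (the datum transported along `K × ℤ^d ≃* ι(K × ℤ^d)`, as in «AutEndStateFCCayley»).
builds on p205010 (kernel theorem, internal audit signed; external expert review pending).
[cite: BenjaminiSchramm1996, Conj. 4; §2 (almost transitive graphs)] [cite: MartineauSevero2019, Cor. 2.2] [cite: Hutchcroft2016, Thm. 1.1] -/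
theorem boxProd_cayley_of_virtually_prod_zd (hcX : X.Connected) (hq : IsQuasiTransitive X) {K : Type} [Group K] {d : ℕ} (hd : 2 ≤ d)
    (ι : K × Multiplicative (Fin d → ℤ) →* Γ) (hι : Function.Injective ι) [ι.range.FiniteIndex]
    (S : Finset Γ) (hS : Subgroup.closure (S : Set Γ) = ⊤) (v : W × Γ) :
    criticalProb (X □ mulCayley (↑S : Set Γ)) v < 1 ∧
      theta (X □ mulCayley (↑S : Set Γ)) v (criticalProbIOf (X □ mulCayley (↑S : Set Γ)) v) = 0 := by
  obtain ⟨ψ₀, ψ₁, a, b, hind, ha, hψa⟩ := AutCyl.exists_centralDatum_prod_zd K hd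
  let e : K × Multiplicative (Fin d → ℤ) ≃* ι.range := MonoidHom.ofInjective hι
  have hχ : ∀ (ψ : K × Multiplicative (Fin d → ℤ) →* Multiplicative ℤ) y, (ψ.comp e.symm.toMonoidHom) (e y) = ψ y := fun ψ y => by
    show ψ (e.symm (e y)) = _; rw [MulEquiv.symm_apply_apply]
  refine boxProd_cayley_conj4_of_vb1_central X hcX hq S hS ι.range (ψ₀.comp e.symm.toMonoidHom) (ψ₁.comp e.symm.toMonoidHom) (e a) (e b) ?_ (e a)
    (fun h => ?_) ?_ v
  · rw [hχ, hχ, hχ, hχ]; exact hind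
  · obtain ⟨y, rfl⟩ := e.surjective h
    rw [← map_mul, ← map_mul, (Subgroup.mem_center_iff.1 ha) y]
  · rw [hχ]; exact Or.inl hψa

end EndStateBoxProd

end Summit.CriticalPhenomena.PercolationContinuityZ3.Theorems.Transplant

end
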